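import Summits.AtomisticToContinuum.Crystallization.Theses.PhononSlackCertificates
import Literature.MathematicalPhysics.StatisticalMechanics.BarlowStackingEnergy
import Summits.AtomisticToContinuum.Crystallization.Theorems.PhononSlackCertificatesPeriodicGivenLayeredLayerCake4

/-!
# `PeriodicGivenLayered` (stmt-AtomisticToContinuum-11779), line `Sketch`: stub `stub_layerCake`

Registered stub `stub_layerCake` of the skeleton of line `Sketch` of the crux
`PhononSlackCertificates.PeriodicGivenLayered` (= `HullMinimality.PeriodicGivenLayered`): the layer-cake
bookkeeping of exactly layered sets `S(A, s, z) = {A (i u(a) + j v(a) + L(m) w(a) + z(m) e₃)}` (`L = haggLabel s`,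
heights `z` with increments in `[39a/50, 17a/20]`, `a ∈ [47/50, 1]`, `A` a linear isometry), with the constant
`C = 192`:

* (a) decay `|layerInteraction V_LJ a H δ 1| ≤ 192 / H⁴` for `|H| ≥ 7/10` (`cake_abs_layerInteraction_le`, part 3,
  from the inverse-cube layer sum bound of part 2);
* (b) `1/2`-separation of `S(A, s, z)` (`cake_separated`, part 1);
* (c) summability over the layers of the layer interactions seen from a layer (`cake_summable_layers`, part 3);
* (d) the site energy of a point of layer `m` is `Φ₀(a) + ∑'_{m' ≠ m} layerInteraction V_LJ a (z m' − z m)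
  (L m' − L m) 1` (`cake_siteEnergy`, part 3 — the regrouping by layers of the absolutely convergent sum);
* (e) the prisms `W(m₁, n, K)`: `W ⊆ S`, `#W = n K²`, `∑_W e_p = K² ∑_m ε_m`, boundary sum `≤ 192 (n K + K²)`
  (`cake_prisms`, part 4).

The Hägg property of `s` and the upper bound `17a/20` on the increments are not needed for these facts.
-/

noncomputable section

namespace Summit.AtomisticToContinuum.Crystallization.Theorems.LayeredHull

open scoped BigOperators
open Filter Literature.MathematicalPhysics.StatisticalMechanics


/-- Deliverable (a) alone (decay of the layer sums), stated without `let`-binders: the registered sub-goal this file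
is matched against. [folklore] -/
theorem cake_layerCake_decay :
    ∃ C : ℝ, ∀ a : ℝ, 47 / 50 ≤ a → a ≤ 1 →
      ∀ (H : ℝ) (δ : ℤ), 7 / 10 ≤ |H| → |layerInteraction lennardJones a H δ 1| ≤ C / H ^ 4 := by
  exact ⟨192, fun a ha ha1 H δ hH => cake_abs_layerInteraction_le a H ha ha1 hH δ⟩

/-- **Stub 6 (layer cake) of line `Sketch`.** For `a ∈ [47/50, 1]`: the layer sums decay like `H⁻⁴`; and for
every linear isometry `A`, Hägg word `s`, heights `z` in the box, the layered set `S = A(S(a,s,z))` is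
`1/2`-separated, the site energy of a point of layer `m` is `Φ₀(a) + Σ'_{m' ≠ m} Φ(z m' − z m, L m' − L m)`
(a summable family), and the prisms `W(m₁,n,K)` satisfy `W ⊆ S`, `#W = n K²`, `Σ_W e_p = K² Σ_m ε_m`,
`∂W ≤ C (nK + K²)`, all with `C = 192`. [folklore] -/
theorem stub_layerCake :
    ∃ C : ℝ, ∀ a : ℝ, 47 / 50 ≤ a → a ≤ 1 →
      (∀ (H : ℝ) (δ : ℤ), 7 / 10 ≤ |H| → |layerInteraction lennardJones a H δ 1| ≤ C / H ^ 4) ∧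
      ∀ (A : (EuclideanSpace ℝ (Fin 3)) →ₗᵢ[ℝ] (EuclideanSpace ℝ (Fin 3))) (s : ℤ → ℤ) (z : ℤ → ℝ), IsHaggSeq s →
        (∀ m : ℤ, 39 / 50 * a ≤ z (m + 1) - z m ∧ z (m + 1) - z m ≤ 17 / 20 * a) →
        let S : Set (EuclideanSpace ℝ (Fin 3)) := {p | ∃ m i j : ℤ, p = A (((i : ℝ) • triangularVec₁ a) +
          ((j : ℝ) • triangularVec₂ a) + ((haggLabel s m : ℝ) • barlowOffset a) + (z m • layerNormal 1))};
        (∀ p ∈ S, ∀ q ∈ S, p ≠ q → 1 / 2 ≤ dist p q) ∧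
        (∀ m : ℤ, Summable fun m' : ℤ => if m' = m then (0 : ℝ) else
          layerInteraction lennardJones a (z m' - z m) (haggLabel s m' - haggLabel s m) 1) ∧
        (∀ m i j : ℤ,
          (∑' q : {q : (EuclideanSpace ℝ (Fin 3)) // q ∈ S ∧ q ≠ A (((i : ℝ) • triangularVec₁ a) + ((j : ℝ) • triangularVec₂ a) +
              ((haggLabel s m : ℝ) • barlowOffset a) + (z m • layerNormal 1))},
            lennardJones (dist (A (((i : ℝ) • triangularVec₁ a) + ((j : ℝ) • triangularVec₂ a) +
              ((haggLabel s m : ℝ) • barlowOffset a) + (z m • layerNormal 1))) (q : (EuclideanSpace ℝ (Fin 3))))) =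
          inLayerInteraction lennardJones a + ∑' m' : ℤ, if m' = m then (0 : ℝ) else
            layerInteraction lennardJones a (z m' - z m) (haggLabel s m' - haggLabel s m) 1) ∧
        (∀ (m₁ : ℤ) (n K : ℕ),
          let W : Finset (EuclideanSpace ℝ (Fin 3)) := ((Finset.Ico m₁ (m₁ + n)) ×ˢ ((Finset.range K) ×ˢ (Finset.range K))).image
            fun t : ℤ × (ℕ × ℕ) => A (((((t.2.1 : ℤ) - haggLabel s t.1 / 3 : ℤ) : ℝ) • triangularVec₁ a) +
              ((((t.2.2 : ℤ) - haggLabel s t.1 / 3 : ℤ) : ℝ) • triangularVec₂ a) +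
              ((haggLabel s t.1 : ℝ) • barlowOffset a) + (z t.1 • layerNormal 1));
          (↑W : Set (EuclideanSpace ℝ (Fin 3))) ⊆ S ∧ W.card = n * K ^ 2 ∧
          (∑ p ∈ W, (∑' q : {q : (EuclideanSpace ℝ (Fin 3)) // q ∈ S ∧ q ≠ p}, lennardJones (dist p (q : (EuclideanSpace ℝ (Fin 3)))))) =
            (K : ℝ) ^ 2 * ∑ m ∈ Finset.Ico m₁ (m₁ + n), (inLayerInteraction lennardJones a +
              ∑' m' : ℤ, if m' = m then (0 : ℝ) else
                layerInteraction lennardJones a (z m' - z m) (haggLabel s m' - haggLabel s m) 1) ∧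
          (∑ p ∈ W, (1 + Metric.infDist p (S \ (↑W : Set (EuclideanSpace ℝ (Fin 3)))))⁻¹ ^ 3) ≤ C * (n * K + K ^ 2)) := by
  refine ⟨192, fun a ha ha1 => ⟨fun H δ hH => cake_abs_layerInteraction_le a H ha ha1 hH δ, ?_⟩⟩
  intro A s z _hs hz S
  have hz' : ∀ m : ℤ, 39 / 50 * a ≤ z (m + 1) - z m := fun m => (hz m).1
  refine ⟨cake_separated a ha A s z hz', fun m => cake_summable_layers a ha ha1 s z hz' m,
    fun m i j => cake_siteEnergy a ha ha1 A s z hz' m i j, fun m₁ n K => ?_⟩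
  intro W
  exact cake_prisms a ha ha1 A s z hz' m₁ n K S rfl W rfl

end Summit.AtomisticToContinuum.Crystallization.Theorems.LayeredHull

end
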